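import Summits.BirchSwinnertonDyer.Rank1Residual.X11b.Three.ClassRecordHsieh
import Summits.BirchSwinnertonDyer.Rank1Residual.X11b.Three.HsiehDescentSupplied
import HarnessLib

/-!
# Class X11b at `p = 3` (team N8/O2 = cell `b2b-bsdres`, seat x11b3-p3): CLASS RECORD v4.5 — a
# READING of v4.4 (`Three/ClassRecordHsieh.lean`, p261556) with the λ-supply hypothesis `hsup`
# DISCHARGED by the tree theorem `Three.lambdaSupplyAt₃` (S24-a, `Three/LambdaSupply.lean`, p264661)

HONEST FRAMING (verbatim, cell `b2b-bsdres`, run/shared/lean/b2b/bsd-rank1-residual/): the goal of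
the cell is to DELETE the COMBINATION-SHAPED residual classes for ALL analytic-rank `≤ 1` curves
over `ℚ` — "full BSD formula for every rank `≤ 1` curve in class `C`" assembled STRICTLY from
published theorems — so that the rank-`≤ 1` remainder becomes exactly the CONSTRUCTION-SHAPED
classes, which are TYPED (missing-input Props), NOT attempted; this is not "finishing BSD".
Team N8/O2 (X11b at `3`; RESIDUAL-MAP §I O2 OPEN). Research route; nothing booked; NO label
changes. THEOREMS ONLY (no definition, no named fact, no `sorry`). Lead rulings R8-21 (e) / R8-29 (c)
(x11b3-lead GEN 7): v4.5 is a READING; the class theorem OF RECORD is v4.3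
(`Three/ClassRecordHalves.lean`, p261173, R8-21 (a)) and the record-pointer is UNCHANGED by this file;
the conjecture binder `Three.HsiehDescentAt₃ W` appears BY NAME as a labelled OPEN hypothesis
(REFEREE A3); sub-populations BY NAME in the types (REFEREE A1); no new def.

## What this file does

v4.4 (`forall_bsdp_of_classRecord_v44`, p261556) read the class record with H1 = BDP-EXISTS@3 supplied
FROM PRINT (Hsieh 2014 Thm. 1, `hH`) GIVEN two further inputs: the λ-SUPPLY hypothesis `hsup` (S24-a's
statement VERBATIM: for every `ι' : ℚ̄₃ ≃ ℂ`, every imaginary quadratic `K` with `3` split and every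
anticyclotomic `ℤ₃`-extension `κ`, a unitary Hecke character `λ` of infinity type `(1,−1)`, trivial on
`𝔸_ℚ^×`, unramified outside `3`, with `3`-adic avatar factoring through `κ`) and the ONE named descent
residual `Three.HsiehDescentAt₃ W` per road. S24-a is now a TREE THEOREM — `Three.lambdaSupplyAt₃`
(x11b3-p7, `Three/LambdaSupply.lean`, p264661; UNCONDITIONAL, axioms standard; with x11b3-p2's parts
(A)/(C)/(B-q)) — and x11b3-p7's `Three/HsiehDescentSupplied.lean` drew the `hsup`-free corollaries at the
residual / A1 level (`hsiehFrameResidualAt₃_of_hsiehDescentAt₃`, `hsiehFrameResidualAt₃_iff_hsiehDescentAt₃`,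
`bdpExistsAt₃_of_hsieh2014_of_hsiehDescentAt₃`, `bsdp_of_halves₃_onA1_of_hsieh2014_of_hsiehDescentAt₃`,
`missingInputAt_of_halves₃_onA1_of_hsieh2014_of_hsiehDescentAt₃`). This file is the CLASS-RECORD level
(IMPORTS p7's corollaries, never re-proves them): every statement below is the v4.4 statement with the
binder `hsup` REMOVED, every proof is ONE line — v4.4 applied to `Three.lambdaSupplyAt₃` (§2–§4) or
v4.4's §1 fed with p7's `hsiehFrameResidualAt₃_iff_hsiehDescentAt₃` (§1).

* §1 **`stepLAt_of_halves₃_of_classX11b_of_hsieh2014_of_hsiehDescentAt₃`** — at EVERY X11b@3 pair,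
  Hsieh 2014 Thm. 1 + `HsiehDescentAt₃ W` + H2 + H3 `⟹ Three.StepLAt W` (class-wide twin of p7's A1
  corollary; CTL₀ class-wide by `Three/CharTorsionClasswide.lean`, p260706).
* §2 **`bsdp_of_halves₃_classwide_of_hsieh2014_of_hsiehDescentAt₃`** — S0's statement of record with
  H1 ↦ Hsieh 2014 Thm. 1 + per pair `HsiehDescentAt₃ W ∧ BDPValueAt₃ W ∧ IMCDivAt₃ W`; no `hsup`.
* §3 **`forall_bsdp_of_classRecord_v45`** — CLASS RECORD v4.5 = v4.4 without `hsup`: binders =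
  PUBLISHED (21) + road (a) `hReg` + road (b) `hDb`, `hHb`, `hSh`, `hUα`, `hUγ` + road (d) `hDd`, `hHd`,
  `hU₀` + corner `hCL`, `hCT`, `hCU`. §4 **`forall_missingInputAt_of_classRecord_v45`** — the same in
  the currency of the cell's typed residual `X11Three.MissingInputAt W` (REFEREE R6.2).

WORDING OF RECORD (REFEREE H45, lead R8-11 / R8-29): S24 does not "shrink" the open remainder at
`3 ‖ N` — its open content is UNCHANGED = (t) = `HsiehDescentAt₃ W`; v4.4 "reads (t) GIVEN (λ)", v4.5
"reads (t), (λ) SUPPLIED" (by `Three.lambdaSupplyAt₃`). WHAT IS LEFT of X11b@3 read through v4.5, by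
named sub-population (binders; TRUE-OPEN counts are EVIDENCE, rmap-3 / x11b3 CLASS RECORD, unchanged by
this file): road (a) NONSPLIT(3) ∧ (ram) [722]: ONE per-pair input `ClassClosure.RegulatorNonvanishingAt
W 3`; road (b) SPLIT(3) ∧ (ram) [961]: `HsiehDescentAt₃ W` [(t), not in print at `3 ∣ N`], H2 =
BDP-VALUE@3 [Cas18 Thm. 3.2 at `3 ∣ N`, not in print], H3 = MI-W3 [no source at `3`] + the (T2′)₃
binders `hSh` / `hUα` / `hUγ` off A1; road (d) [1]: the same + `hU₀`; the (T4″)₃ corner [0 TRUE-OPEN]: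
`hCL` / `hCT` / `hCU`. CONDITIONAL on every listed binder; nothing booked; O2 OPEN; X11 ∧ `r = 1` ∧
`p = 3` stays CONSTRUCTION-SHAPED (R6.2); no label / count / mark moves.

References: [Hsieh2014] Thm. 1 (arXiv:1112.1580 pp. 3–4); [Weil1956] §1–§2; [Greenberg1987] §2;
[Castella2018] Thm. 2.3 (p. 5), Thm. 3.2 (p. 9), §5 (p. 12) (arXiv:1704.06608); [GreenbergLNM1716]
§3 Lemma 3.3; [Kolyvagin1990] Thm. A; [Skinner2016PacificMC] Thm. A, Thm. C; [SteinWuthrich2013]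
Thm. 6.1, §4.2; [Disegni2020] Thm. 1; [MatarNekovar2019] Thm. 0.3; [BarriosEtAl2025] Thm. 5.1;
[Wuthrich2014] Prop. 21; [Miller2011LMS] Def. 1.1.
-/

noncomputable section

open scoped Classical

open WeierstrassCurve NumberField IsDedekindDomain Field Literature.NumberTheory.EllipticCurves
  Rat.HeightOneSpectrum
  Literature.NumberTheory.DiophantineGeometry
  Literature.NumberTheory.EllipticCurves.GreenbergSelmer
  Literature.NumberTheory.EllipticCurves.ModularForms
  Literature.NumberTheory.EllipticCurves.Rank1Residual
  Literature.NumberTheory.EllipticCurves.Rank1Residual.Typed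
  Literature.NumberTheory.EllipticCurves.Wuthrich2014
  Literature.NumberTheory.EllipticCurves.BalakrishnanEtAl2019
  Literature.NumberTheory.EllipticCurves.Skinner2016
  Literature.NumberTheory.EllipticCurves.SteinWuthrich2013
  Literature.NumberTheory.EllipticCurves.Disegni2020
  Literature.NumberTheory.EllipticCurves.BarriosEtAl2025
  Literature.NumberTheory.QuadraticFields.Quadratic
  Literature.NumberTheory.Automorphic
  Literature.NumberTheory.GaloisRepresentations Literature.NumberTheory.GaloisCohomology
  Summit.BirchSwinnertonDyer.Rank1Residual.X11b.AcSelmer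
  Summit.BirchSwinnertonDyer.Rank1Residual.X11b.LocBridge

namespace Summit.BirchSwinnertonDyer.Rank1Residual.X11b.Three

/-! ### §1. `Three.StepLAt W` at every X11b@3 pair from print + (t) + H2 + H3, (λ) supplied -/

/-- **`Three.StepLAt W` at EVERY X11b@3 pair from Hsieh 2014 Thm. 1 + the descent residual + H2 + H3,
the λ-supply SUPPLIED**: `stepLAt_of_halves₃_of_classX11b_of_hsieh2014` (v4.4 §1; CTL₀ discharged
class-wide) with the S18 residual supplied by x11b3-p7's `hsiehFrameResidualAt₃_iff_hsiehDescentAt₃`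
(`Three/HsiehDescentSupplied.lean`, direction `⇐`: the λ-supply `:=` the theorem `Three.lambdaSupplyAt₃`) from the ONE
named descent residual `hdesc : HsiehDescentAt₃ W` (S24-b, NOT in print at `3 ∣ N`) ALONE — v4.4's
`…_of_descent` without its `hsup` binder. Class-wide twin of p7's
`bsdp_of_halves₃_onA1_of_hsieh2014_of_hsiehDescentAt₃` reading. Reads (t), (λ) supplied; CONDITIONAL on the
four named facts, the named residual and the two typed halves; nothing booked; O2 OPEN.
[cite: Hsieh2014, Thm. 1 (arXiv:1112.1580 pp. 3–4)] [cite: Castella2018, p. 9 l. 42 (arXiv:1704.06608)]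
[cite: GreenbergLNM1716, §3 Lemma 3.3 (p. 87)] -/
theorem stepLAt_of_halves₃_of_classX11b_of_hsieh2014_of_hsiehDescentAt₃ {W : WeierstrassCurve ℚ}
    [W.IsElliptic] [W.IsGloballyMinimal] (hnf : exists_isNewformOf)
    (hKo : ∀ (N : ℕ) [NeZero N] (W : WeierstrassCurve ℚ) (K : Type) [Field K] [NumberField K],
      kolyvagin N W K)
    (hPT : ∀ (K : Type) [Field K] [NumberField K], poitouTate_sum_localTatePairing_eq_zero K)
    (hEP : ∀ (K : Type) [Field K] [NumberField K] (v : HeightOneSpectrum (𝓞 K)),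
      localEulerPoincareCharacteristic (v.adicCompletion K))
    (hH : hsieh2014_exists_anticyclotomicPAdicLFunction)
    (hX : ClassX11b W 3) (hdesc : HsiehDescentAt₃ W) (h2 : BDPValueAt₃ W) (h3 : IMCDivAt₃ W) :
    StepLAt W :=
  stepLAt_of_halves₃_of_classX11b_of_hsieh2014 hnf hKo hPT hEP hH hX
    ((hsiehFrameResidualAt₃_iff_hsiehDescentAt₃ W).2 hdesc) h2 h3

/-! ### §2. S0's statement of record: H1 from print, (λ) supplied, reading (t), class-wide -/

/-- **S0's statement of record with (T1)₃ supplied from print, the λ-supply SUPPLIED, reading the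
descent residual, class-wide**: `bsdp_of_halves₃_classwide_of_hsieh2014_of_descent` (v4.4 §2: the twelve
published facts of `Three.bsdp_of_stepLAt` + Hsieh 2014 Thm. 1 `hH` + (T2′)₃ + (T4″)₃, NO control binder)
with its `hsup` binder `:=` `Three.lambdaSupplyAt₃` (p264661). Per X11b@3 pair with `ρ̄_{E,3}` onto the
input is the named descent residual `HsiehDescentAt₃ W` together with H2 ∧ H3 (`hR`). CONDITIONAL on
every listed binder; nothing booked; RESIDUAL-MAP §I O2 unchanged.
[cite: Hsieh2014, Thm. 1 (arXiv:1112.1580 pp. 3–4)] [cite: Weil1956, §1–§2]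
[cite: Castella2018, Thm. 2.3 (p. 5), Thm. 3.2 (p. 9), §5 (p. 12)] [cite: Skinner2016PacificMC, Thm. C (§1) and footnote 1]
[cite: Wuthrich2014, Prop. 21 (p. 400)] [cite: Miller2011LMS, Def. 1.1] -/
theorem bsdp_of_halves₃_classwide_of_hsieh2014_of_hsiehDescentAt₃
    (hGZ : ∀ (N : ℕ) [NeZero N] (W : WeierstrassCurve ℚ) (K : Type) [Field K] [NumberField K],
      gross_zagier N W K)
    (hKo : ∀ (N : ℕ) [NeZero N] (W : WeierstrassCurve ℚ) (K : Type) [Field K] [NumberField K],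
      kolyvagin N W K)
    (hB : ∀ (N : ℕ) [NeZero N] (W : WeierstrassCurve ℚ) (K : Type) [Field K] [NumberField K],
      Kolyvagin1990_padicValNat_card_sha_le N W K)
    (hSk : Skinner2016.thmC_padicValRat_bsd_rank_zero) (hWu : sha_dvd_analyticSha)
    (hGZK : rank_eq_analyticRank_of_analyticRank_le_one) (hmod : hasEntireLFunction_rat)
    (hnf : exists_isNewformOf) (hHL : HoffsteinLuo1997_exists_twist_L_one_ne_zero)
    (hMaz : mazur_not_dvd_maninConstant_of_odd)
    (hPT : ∀ (K : Type) [Field K] [NumberField K], poitouTate_sum_localTatePairing_eq_zero K)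
    (hEP : ∀ (K : Type) [Field K] [NumberField K] (v : HeightOneSpectrum (𝓞 K)),
      localEulerPoincareCharacteristic (v.adicCompletion K))
    -- PUBLISHED: Hsieh 2014 Thm. 1 (S18 (a), p258780)
    (hH : hsieh2014_exists_anticyclotomicPAdicLFunction)
    -- per pair: the ONE named descent residual (S24-b) + H2 ∧ H3 — TYPED, construction-shaped
    (hR : ∀ (W : WeierstrassCurve ℚ) [W.IsElliptic] [W.IsGloballyMinimal],
      ClassX11b W 3 → Surj W 3 → HsiehDescentAt₃ W ∧ BDPValueAt₃ W ∧ IMCDivAt₃ W)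
    -- (T2′)₃ the Euler-system half off the unconditional atom (ram) ∧ `3 ∤ ∏ c_ℓ`
    (hU : ∀ (W : WeierstrassCurve ℚ) [W.IsElliptic] [W.IsGloballyMinimal],
      ClassX11b W 3 → Surj W 3 → ¬ (Ram W 3 ∧ ¬ 3 ∣ W.tamagawaProduct) →
        Typed.MissingUpperBoundAt W 3)
    -- (T4″)₃ the non-surjective corner `3 ∣ ord₃ Δ_min`, no (ram) prime
    (hC : ∀ (W : WeierstrassCurve ℚ) [W.IsElliptic] [W.IsGloballyMinimal],
      ClassX11b W 3 → ¬ Surj W 3 → 3 ∣ padicValInt 3 W.minimalDiscriminantInt → ¬ Ram W 3 →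
        Typed.MissingPPartAt W 3)
    (W : WeierstrassCurve ℚ) [W.IsElliptic] [W.IsGloballyMinimal] (hX : ClassX11b W 3) :
    BSDp W 3 :=
  bsdp_of_halves₃_classwide_of_hsieh2014_of_descent hGZ hKo hB hSk hWu hGZK hmod hnf hHL hMaz hPT hEP hH
    lambdaSupplyAt₃ hR hU hC W hX

/-! ### §3. CLASS RECORD v4.5 — the record read with H1 from print, (λ) supplied, residual (t) -/

/-- **X11b at `p = 3`, WHOLE CLASS — CLASS RECORD v4.5 IN KERNEL FORM (a READING of v4.4 / v4.3).**
`forall_bsdp_of_classRecord_v44` (p261556) with its λ-supply binder `hsup` `:=` the tree theorem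
`Three.lambdaSupplyAt₃` (S24-a, p264661, UNCONDITIONAL) — i.e. v4.4's statement with `hsup` REMOVED and
nothing else changed. Binder list: PUBLISHED (21) = v4.3's twenty + Hsieh 2014 Thm. 1 (`hH`); road (a):
`hReg`; road (b): the named descent residual `hDb : … → HsiehDescentAt₃ W` (S24-b, NOT in print at
`3 ∣ N`), `hHb` (H2 ∧ H3), `hSh`, `hUα`, `hUγ`; road (d): `hDd`, `hHd`, `hU₀`; corner: `hCL`, `hCT`,
`hCU`. The class theorem OF RECORD is v4.3 (p261173, lead R8-21 (a)); v4.5 reads (t), (λ) SUPPLIED.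
CONDITIONAL on every listed binder; nothing booked; labels UNCHANGED (X11 ∧ `r = 1` ∧ `p = 3`
CONSTRUCTION-SHAPED, R6.2; O2 OPEN).
[cite: Hsieh2014, Thm. 1 (arXiv:1112.1580 pp. 3–4)] [cite: Weil1956, §1–§2] [cite: Greenberg1987, §2]
[cite: Castella2018, Thm. 2.3 (p. 5), Thm. 3.2 (p. 9), §5 (p. 12)] [cite: GreenbergLNM1716, §3 Lemma 3.3 (p. 87)]
[cite: Skinner2016PacificMC, Thm. A and Thm. C (§1)] [cite: SteinWuthrich2013, Thm. 6.1, §4.2]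
[cite: Disegni2020, Thm. 1 (§1.2)] [cite: MatarNekovar2019, Thm. 0.3 (p. 456)]
[cite: BarriosEtAl2025, Thm. 5.1 (rows R = I₀)] [cite: Wuthrich2014, Prop. 21 (p. 400)] [cite: Miller2011LMS, Def. 1.1] -/
theorem forall_bsdp_of_classRecord_v45 [Fact (Nat.Prime 3)]
    -- PUBLISHED: the twelve named facts of route p2
    (hGZ : ∀ (N : ℕ) [NeZero N] (W : WeierstrassCurve ℚ) (K : Type) [Field K] [NumberField K],
      gross_zagier N W K)
    (hKo : ∀ (N : ℕ) [NeZero N] (W : WeierstrassCurve ℚ) (K : Type) [Field K] [NumberField K],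
      kolyvagin N W K)
    (hB : ∀ (N : ℕ) [NeZero N] (W : WeierstrassCurve ℚ) (K : Type) [Field K] [NumberField K],
      Kolyvagin1990_padicValNat_card_sha_le N W K)
    (hSk : Skinner2016.thmC_padicValRat_bsd_rank_zero) (hWu : sha_dvd_analyticSha)
    (hGZK : rank_eq_analyticRank_of_analyticRank_le_one) (hmod : hasEntireLFunction_rat)
    (hnf : exists_isNewformOf) (hHL : HoffsteinLuo1997_exists_twist_L_one_ne_zero)
    (hMaz : mazur_not_dvd_maninConstant_of_odd)
    (hPT : ∀ (K : Type) [Field K] [NumberField K], poitouTate_sum_localTatePairing_eq_zero K)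
    (hEP : ∀ (K : Type) [Field K] [NumberField K] (v : HeightOneSpectrum (𝓞 K)),
      localEulerPoincareCharacteristic (v.adicCompletion K))
    -- PUBLISHED: Friedberg–Hoffstein, Barrios et al. 2025 (binder at `2`), road (a)'s five,
    -- Matar–Nekovář 2019 Thm. 0.3 (the corner's `K`-bound), Hsieh 2014 Thm. 1 (S18 (a))
    (hFH : friedbergHoffstein_exists_twist_ne_zero_inertAt)
    (hBR : localTamagawaNumber_quadraticTwist_two_mem_of_goodReduction)
    (hSkA : thmA_charIdeal_multiplicative) (hJn : thm61_nonsplitMultiplicative)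
    (hHn : exists_isMultCanonical) (hD : thm1_padicBSD_rankOne_multiplicative)
    (hpar : nonempty_modularParametrizationData)
    (hMN : ∀ (N : ℕ) [NeZero N] (W : WeierstrassCurve ℚ) (K : Type) [Field K] [NumberField K],
      MatarNekovar2019.thm03_padicValNat_card_sha_le_of_irreducible N W K)
    (hH : hsieh2014_exists_anticyclotomicPAdicLFunction)
    -- ROAD (a) NONSPLIT(3) ∧ (ram): ONE per-pair input
    (hReg : ∀ (W : WeierstrassCurve ℚ) [W.IsElliptic] [W.IsGloballyMinimal],
      ClassX11b W 3 → Ram W 3 → ¬ W.HasSplitMultiplicativeReductionAtPrime 3 →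
        ClassClosure.RegulatorNonvanishingAt W 3)
    -- ROAD (b) SPLIT(3) ∧ (ram): the ONE named descent residual (S24-b), H2 ∧ H3, displays on pure-β,
    -- α / γ∖α
    (hDb : ∀ (W : WeierstrassCurve ℚ) [W.IsElliptic] [W.IsGloballyMinimal],
      ClassX11b W 3 → Ram W 3 → W.HasSplitMultiplicativeReductionAtPrime 3 → HsiehDescentAt₃ W)
    (hHb : ∀ (W : WeierstrassCurve ℚ) [W.IsElliptic] [W.IsGloballyMinimal],
      ClassX11b W 3 → Ram W 3 → W.HasSplitMultiplicativeReductionAtPrime 3 →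
        BDPValueAt₃ W ∧ IMCDivAt₃ W)
    (hSh : ∀ (W : WeierstrassCurve ℚ) [W.IsElliptic] [W.IsGloballyMinimal],
      ClassX11b W 3 → Ram W 3 → W.HasSplitMultiplicativeReductionAtPrime 3 → ¬ ShapeAlpha W →
        ¬ ShapeGamma W → 3 ∣ W.tamagawaProduct → P2ShimuraDisplaysAt W 3)
    (hUα : ∀ (W : WeierstrassCurve ℚ) [W.IsElliptic] [W.IsGloballyMinimal],
      ClassX11b W 3 → Ram W 3 → ShapeAlpha W → Typed.MissingUpperBoundAt W 3)
    (hUγ : ∀ (W : WeierstrassCurve ℚ) [W.IsElliptic] [W.IsGloballyMinimal],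
      ClassX11b W 3 → Ram W 3 → W.HasSplitMultiplicativeReductionAtPrime 3 → ¬ ShapeAlpha W →
        ShapeGamma W → Typed.MissingUpperBoundAt W 3)
    -- ROAD (d) `¬Ram ∧ Surj`: the descent residual, H2 ∧ H3, the upper half
    (hDd : ∀ (W : WeierstrassCurve ℚ) [W.IsElliptic] [W.IsGloballyMinimal],
      ClassX11b W 3 → ¬ Ram W 3 → Surj W 3 → HsiehDescentAt₃ W)
    (hHd : ∀ (W : WeierstrassCurve ℚ) [W.IsElliptic] [W.IsGloballyMinimal],
      ClassX11b W 3 → ¬ Ram W 3 → Surj W 3 → BDPValueAt₃ W ∧ IMCDivAt₃ W)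
    (hU₀ : ∀ (W : WeierstrassCurve ℚ) [W.IsElliptic] [W.IsGloballyMinimal],
      ClassX11b W 3 → Surj W 3 → ¬ Ram W 3 → Typed.MissingUpperBoundAt W 3)
    -- THE (T4″)@3 CORNER `¬Surj` (x11b3-p8's typed inputs, `CornerResidual.lean`, p253638)
    (hCL : ∀ (W : WeierstrassCurve ℚ) [W.IsElliptic] [W.IsGloballyMinimal], CornerStepLAt W)
    (hCT : ∀ (W : WeierstrassCurve ℚ) [W.IsElliptic] [W.IsGloballyMinimal], CornerTwistAt W)
    (hCU : ∀ (W : WeierstrassCurve ℚ) [W.IsElliptic] [W.IsGloballyMinimal], CornerUpperAt W)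
    (W : WeierstrassCurve ℚ) [W.IsElliptic] [W.IsGloballyMinimal] (hX : ClassX11b W 3) :
    BSDp W 3 :=
  forall_bsdp_of_classRecord_v44 hGZ hKo hB hSk hWu hGZK hmod hnf hHL hMaz hPT hEP hFH hBR hSkA hJn
    hHn hD hpar hMN hH lambdaSupplyAt₃ hReg hDb hHb hSh hUα hUγ hDd hHd hU₀ hCL hCT hCU W hX

/-! ### §4. CLASS RECORD v4.5 in the currency of the cell's typed residual -/

/-- **CLASS RECORD v4.5 ⟹ the CLASS's typed missing input at every X11b@3 pair.** Under exactly the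
binders of `forall_bsdp_of_classRecord_v45` (21 published facts; road (a)'s per-pair
`RegulatorNonvanishingAt W 3`; road (b)'s / road (d)'s descent residual `HsiehDescentAt₃ W`, H2 ∧ H3 and
(T2′)₃ binders; the corner's three typed inputs — NO λ-supply binder, `Three.lambdaSupplyAt₃` being a
theorem), the typed residual of RESIDUAL-MAP §I O2 / REFEREE R6.2, `X11Three.MissingInputAt W`, holds
at every pair of the class (`forall_missingInputAt_of_classRecord_v44` applied to `Three.lambdaSupplyAt₃`).
CONDITIONAL; nothing booked; O2 OPEN; no label change.
[cite: Miller2011LMS, §1 and Def. 1.1] [cite: Hsieh2014, Thm. 1 (arXiv:1112.1580 pp. 3–4)]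
[cite: Castella2018, Thm. 2.3 (p. 5), Thm. 3.2 (p. 9), §5 (p. 12)] [cite: Skinner2016PacificMC, Thm. A and Thm. C (§1)]
[cite: Disegni2020, Thm. 1 (§1.2)] [cite: MatarNekovar2019, Thm. 0.3 (p. 456)] [cite: BarriosEtAl2025, Thm. 5.1 (rows R = I₀)] -/
theorem forall_missingInputAt_of_classRecord_v45 [Fact (Nat.Prime 3)]
    (hGZ : ∀ (N : ℕ) [NeZero N] (W : WeierstrassCurve ℚ) (K : Type) [Field K] [NumberField K],
      gross_zagier N W K)
    (hKo : ∀ (N : ℕ) [NeZero N] (W : WeierstrassCurve ℚ) (K : Type) [Field K] [NumberField K],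
      kolyvagin N W K)
    (hB : ∀ (N : ℕ) [NeZero N] (W : WeierstrassCurve ℚ) (K : Type) [Field K] [NumberField K],
      Kolyvagin1990_padicValNat_card_sha_le N W K)
    (hSk : Skinner2016.thmC_padicValRat_bsd_rank_zero) (hWu : sha_dvd_analyticSha)
    (hGZK : rank_eq_analyticRank_of_analyticRank_le_one) (hmod : hasEntireLFunction_rat)
    (hnf : exists_isNewformOf) (hHL : HoffsteinLuo1997_exists_twist_L_one_ne_zero)
    (hMaz : mazur_not_dvd_maninConstant_of_odd)
    (hPT : ∀ (K : Type) [Field K] [NumberField K], poitouTate_sum_localTatePairing_eq_zero K)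
    (hEP : ∀ (K : Type) [Field K] [NumberField K] (v : HeightOneSpectrum (𝓞 K)),
      localEulerPoincareCharacteristic (v.adicCompletion K))
    (hFH : friedbergHoffstein_exists_twist_ne_zero_inertAt)
    (hBR : localTamagawaNumber_quadraticTwist_two_mem_of_goodReduction)
    (hSkA : thmA_charIdeal_multiplicative) (hJn : thm61_nonsplitMultiplicative)
    (hHn : exists_isMultCanonical) (hD : thm1_padicBSD_rankOne_multiplicative)
    (hpar : nonempty_modularParametrizationData)
    (hMN : ∀ (N : ℕ) [NeZero N] (W : WeierstrassCurve ℚ) (K : Type) [Field K] [NumberField K],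
      MatarNekovar2019.thm03_padicValNat_card_sha_le_of_irreducible N W K)
    (hH : hsieh2014_exists_anticyclotomicPAdicLFunction)
    (hReg : ∀ (W : WeierstrassCurve ℚ) [W.IsElliptic] [W.IsGloballyMinimal],
      ClassX11b W 3 → Ram W 3 → ¬ W.HasSplitMultiplicativeReductionAtPrime 3 →
        ClassClosure.RegulatorNonvanishingAt W 3)
    (hDb : ∀ (W : WeierstrassCurve ℚ) [W.IsElliptic] [W.IsGloballyMinimal],
      ClassX11b W 3 → Ram W 3 → W.HasSplitMultiplicativeReductionAtPrime 3 → HsiehDescentAt₃ W)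
    (hHb : ∀ (W : WeierstrassCurve ℚ) [W.IsElliptic] [W.IsGloballyMinimal],
      ClassX11b W 3 → Ram W 3 → W.HasSplitMultiplicativeReductionAtPrime 3 →
        BDPValueAt₃ W ∧ IMCDivAt₃ W)
    (hSh : ∀ (W : WeierstrassCurve ℚ) [W.IsElliptic] [W.IsGloballyMinimal],
      ClassX11b W 3 → Ram W 3 → W.HasSplitMultiplicativeReductionAtPrime 3 → ¬ ShapeAlpha W →
        ¬ ShapeGamma W → 3 ∣ W.tamagawaProduct → P2ShimuraDisplaysAt W 3)
    (hUα : ∀ (W : WeierstrassCurve ℚ) [W.IsElliptic] [W.IsGloballyMinimal],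
      ClassX11b W 3 → Ram W 3 → ShapeAlpha W → Typed.MissingUpperBoundAt W 3)
    (hUγ : ∀ (W : WeierstrassCurve ℚ) [W.IsElliptic] [W.IsGloballyMinimal],
      ClassX11b W 3 → Ram W 3 → W.HasSplitMultiplicativeReductionAtPrime 3 → ¬ ShapeAlpha W →
        ShapeGamma W → Typed.MissingUpperBoundAt W 3)
    (hDd : ∀ (W : WeierstrassCurve ℚ) [W.IsElliptic] [W.IsGloballyMinimal],
      ClassX11b W 3 → ¬ Ram W 3 → Surj W 3 → HsiehDescentAt₃ W)
    (hHd : ∀ (W : WeierstrassCurve ℚ) [W.IsElliptic] [W.IsGloballyMinimal],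
      ClassX11b W 3 → ¬ Ram W 3 → Surj W 3 → BDPValueAt₃ W ∧ IMCDivAt₃ W)
    (hU₀ : ∀ (W : WeierstrassCurve ℚ) [W.IsElliptic] [W.IsGloballyMinimal],
      ClassX11b W 3 → Surj W 3 → ¬ Ram W 3 → Typed.MissingUpperBoundAt W 3)
    (hCL : ∀ (W : WeierstrassCurve ℚ) [W.IsElliptic] [W.IsGloballyMinimal], CornerStepLAt W)
    (hCT : ∀ (W : WeierstrassCurve ℚ) [W.IsElliptic] [W.IsGloballyMinimal], CornerTwistAt W)
    (hCU : ∀ (W : WeierstrassCurve ℚ) [W.IsElliptic] [W.IsGloballyMinimal], CornerUpperAt W)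
    (W : WeierstrassCurve ℚ) [W.IsElliptic] [W.IsGloballyMinimal] (hX : ClassX11b W 3) :
    X11Three.MissingInputAt W :=
  forall_missingInputAt_of_classRecord_v44 hGZ hKo hB hSk hWu hGZK hmod hnf hHL hMaz hPT hEP hFH hBR
    hSkA hJn hHn hD hpar hMN hH lambdaSupplyAt₃ hReg hDb hHb hSh hUα hUγ hDd hHd hU₀ hCL hCT hCU W hX

end Summit.BirchSwinnertonDyer.Rank1Residual.X11b.Three

end
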